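import Summits.RiemannHypothesis.RiemannHypothesis.Theorems.LiTailLaguerreLiTailContour
import Summits.RiemannHypothesis.RiemannHypothesis.Theorems.LiPrimeEchoGammaShift
import Literature.Analysis.SpecialFunctions.DigammaLogBound
import HarnessLib

/-!
# RiemannHypothesis / LiTailLaguerre — crux K3′ `LiGammaTailShift`, part 1: the co-weight and the gamma factor on the
# strip `[1/2, 3/2] × [T, ∞)` for a general cut `T ≥ c√n` (RH-FREE)

RH-FREE [rh-li-eng-2 g4; binder K3′ of round 7, DEALING.md «tail-p1 when minted; else any idle prover»].  Route
`Theses/LiTailLaguerre.lean` (rung «Li TAIL–LAGUERRE LAW» `LiTheory.LiZeroTailLaguerre`, L-P(P1-tail); cell `pub/rh-li`,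
dossier `theory/route/r7`), item `LiGammaTailShift` (stmt-RiemannHypothesis-19704): the gamma piece of the right edge of
the half-strip, shifted to the critical line, IS the smooth tail `liSmoothTail n T` up to a connector at height `T` of size
`O(log n)`.  This file supplies the pointwise estimates on the strip that the Cauchy shift (part 2) and the connector
bound need, for an ARBITRARY `c > 0` (the closed route LiPrimeEcho only needed `c ≥ 1`, i.e. `T² ≥ n`):

* `‖F_n(x + iT)‖ ≤ e^{n/T²}` for `x ≥ −1/2`, `T > 0` (`|1 − 1/s|² ≤ 1 + 2/T²`; `norm_liWeight_le_exp_div`) and the same for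
  `F_n(1 − w)`, `Re w ≤ 3/2` (conjugation); `‖F_n(w)‖ ≤ 1` for `Re w ≥ 1/2`;
* the CO-WEIGHT `2 − k_n(w) = (1 − F_n(w)) + (1 − F_n(1 − w))` on `x ∈ [1/2, 3/2]`: `‖2 − k_n(x + iT)‖ ≤ 3 + e^{n/T²}`
  (`T > 0`) and `‖2 − k_n(x + iY)‖ ≤ 2ne/Y` for `Y² ≥ n` (eng g5's `TailContour.norm_one_sub_liWeight_le`);
* the gamma factor `g(w) = −½ log π + ½ ψ(w/2)`: `‖g(x + iT)‖ ≤ ½ log(T + 4) + 5` (`norm_digamma_le_log_height`);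
* the co-gamma integrand `G̃_n(w) = g(w)(2 − k_n(w))` (`= TailContour.gammaIntegrand n y` at `w = 3/2 + iy` by `rfl`):
  analytic on `Re w > 0, Im w ≠ 0`, real part `2 f_n(t) ϑ'(t) = 2 · liWindowWeight n t · liGammaDensity t` on the
  critical line (`GammaShift.liSymWeight_half_line`), and the two connector bounds
  `‖∫_{1/2}^{3/2} G̃_n(x + iT) dx‖ ≤ (½ log(T + 4) + 5)(3 + e^{n/T²})`, `‖∫_{1/2}^{3/2} G̃_n(x + iY) dx‖ ≤ (½ log(Y + 4) + 5)·2ne/Y`.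

Template: the PROVED `Theorems/LiPrimeEchoGammaShift.lean` (crux K4 of route LiPrimeEcho).  Elementary estimates about a
smooth archimedean integrand; nothing about zeros; nothing here bears on the truth of RH.
-/

noncomputable section

-- D-0017: `Summit.<S>.<S>.…` is the designed namespace of a single-problem summit.
set_option linter.dupNamespace false

open Complex MeasureTheory intervalIntegral Set Filter
open scoped Real Interval Topology ComplexConjugate

namespace Summit.RiemannHypothesis.RiemannHypothesis.Theorems.LiTheory

open Literature.NumberTheory.LFunctions

namespace GammaTail

/-! ### The Li weight on the strip for a general cut -/

/-- `‖F_n(x + iT)‖ ≤ e^{n/T²}` for `x ≥ −1/2`, `T > 0` (`|1 − 1/s|² = 1 + (1 − 2x)/|s|² ≤ 1 + 2/T²`, `(1 + 2/T²)ⁿ ≤ e^{2n/T²}`). -/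
theorem norm_liWeight_le_exp_div (n : ℕ) {x T : ℝ} (hx : -(1 / 2 : ℝ) ≤ x) (hT : 0 < T) :
    ‖liWeight n (x + T * I)‖ ≤ Real.exp (n / T ^ 2) := by
  unfold liWeight
  rw [norm_pow]
  set s : ℂ := x + T * I with hs
  have hsim : s.im = T := by simp [hs]
  have hsre : s.re = x := by simp [hs]
  have hs0 : s ≠ 0 := fun h ↦ by rw [h, Complex.zero_im] at hsim; exact hT.ne' hsim.symm
  have hq' : 1 - 1 / s = (s - 1) / s := by field_simp
  rw [hq']
  set q : ℝ := ‖(s - 1) / s‖ with hq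
  have hq0 : 0 ≤ q := norm_nonneg _
  have hns : ‖s‖ ^ 2 = x ^ 2 + T ^ 2 := by rw [Complex.sq_norm, Complex.normSq_apply, hsre, hsim]; ring
  have hns1 : ‖s - 1‖ ^ 2 = (x - 1) ^ 2 + T ^ 2 := by
    rw [Complex.sq_norm, Complex.normSq_apply]; simp [hs]; ring
  have hq2 : q ^ 2 = ((x - 1) ^ 2 + T ^ 2) / (x ^ 2 + T ^ 2) := by rw [hq, norm_div, div_pow, hns, hns1]
  have hT2 : 0 < T ^ 2 := by positivity
  have hq2le : q ^ 2 ≤ 1 + 2 / T ^ 2 := by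
    rw [hq2, div_le_iff₀ (by positivity)]
    have h2 : 2 ≤ (2 : ℝ) / T ^ 2 * (x ^ 2 + T ^ 2) := by
      rw [div_mul_eq_mul_div, le_div_iff₀ hT2]; nlinarith [sq_nonneg x]
    nlinarith [sq_nonneg x]
  have hexp : 1 + 2 / T ^ 2 ≤ Real.exp (2 / T ^ 2) := by
    have := Real.add_one_le_exp (2 / T ^ 2); linarith
  have hpow : (q ^ 2) ^ n ≤ Real.exp (n / T ^ 2) ^ 2 := by
    calc (q ^ 2) ^ n ≤ (1 + 2 / T ^ 2) ^ n := pow_le_pow_left₀ (sq_nonneg _) hq2le n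
      _ ≤ Real.exp (2 / T ^ 2) ^ n := pow_le_pow_left₀ (by positivity) hexp n
      _ = Real.exp (n / T ^ 2) ^ 2 := by
          rw [← Real.exp_nat_mul, ← Real.exp_nat_mul]; congr 1; push_cast; ring
  have hsq : (q ^ n) ^ 2 ≤ Real.exp (n / T ^ 2) ^ 2 := by rw [← pow_mul, mul_comm, pow_mul]; exact hpow
  exact (pow_le_pow_iff_left₀ (pow_nonneg hq0 n) (Real.exp_pos _).le two_ne_zero).1 hsq

/-- `‖F_n(1 − (x + iT))‖ ≤ e^{n/T²}` for `x ≤ 3/2`, `T > 0` (conjugation symmetry). -/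
theorem norm_liWeight_one_sub_le_exp_div (n : ℕ) {x T : ℝ} (hx : x ≤ 3 / 2) (hT : 0 < T) :
    ‖liWeight n (1 - (x + T * I))‖ ≤ Real.exp (n / T ^ 2) := by
  have h := norm_liWeight_le_exp_div n (x := 1 - x) (T := T) (by linarith) hT
  have hconj : (1 : ℂ) - (x + T * I) = conj (((1 - x : ℝ) : ℂ) + T * I) := by
    apply Complex.ext <;> simp
  have hnorm : ∀ s : ℂ, ‖liWeight n (conj s)‖ = ‖liWeight n s‖ := by
    intro s
    unfold liWeight
    rw [show (1 : ℂ) - 1 / conj s = conj (1 - 1 / s) by simp [map_sub], ← map_pow, Complex.norm_conj]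
  rw [hconj, hnorm]
  simpa using h

/-- `‖F_n(w)‖ ≤ 1` for `Re w ≥ 1/2` (`|w − 1| ≤ |w|`). -/
theorem norm_liWeight_le_one (n : ℕ) {w : ℂ} (hw : 1 / 2 ≤ w.re) (hw0 : w ≠ 0) : ‖liWeight n w‖ ≤ 1 := by
  unfold liWeight
  rw [norm_pow]
  refine pow_le_one₀ (norm_nonneg _) ?_
  rw [show (1 : ℂ) - 1 / w = (w - 1) / w by field_simp, norm_div, div_le_one (norm_pos_iff.2 hw0)]
  have h1 : ‖w - 1‖ ^ 2 ≤ ‖w‖ ^ 2 := by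
    rw [Complex.sq_norm, Complex.sq_norm, Complex.normSq_apply, Complex.normSq_apply]
    simp only [Complex.sub_re, Complex.one_re, Complex.sub_im, Complex.one_im, sub_zero]
    nlinarith
  exact (pow_le_pow_iff_left₀ (norm_nonneg _) (norm_nonneg _) two_ne_zero).1 h1

/-! ### The co-weight `2 − k_n` on the strip -/

/-- `2 − k_n(w) = (1 − F_n(w)) + (1 − F_n(1 − w))`. -/
theorem liCoSymWeight_eq (n : ℕ) (w : ℂ) :
    liCoSymWeight n w = (1 - liWeight n w) + (1 - liWeight n (1 - w)) := by
  unfold liCoSymWeight liSymWeight; ring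

/-- **Co-weight bound for a general cut**: `‖2 − k_n(x + iT)‖ ≤ 3 + e^{n/T²}` for `x ∈ [1/2, 3/2]`, `T > 0`. -/
theorem norm_liCoSymWeight_le (n : ℕ) {x T : ℝ} (hx : x ∈ Icc (1 / 2 : ℝ) (3 / 2)) (hT : 0 < T) :
    ‖liCoSymWeight n (x + T * I)‖ ≤ 3 + Real.exp (n / T ^ 2) := by
  have hw0 : (x : ℂ) + T * I ≠ 0 := fun h ↦ by
    have := congrArg Complex.im h; simp at this; exact hT.ne' this
  have hre : 1 / 2 ≤ ((x : ℂ) + T * I).re := by simpa using hx.1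
  have h1 : ‖liWeight n (x + T * I)‖ ≤ 1 := norm_liWeight_le_one n hre hw0
  have h2 : ‖liWeight n (1 - (x + T * I))‖ ≤ Real.exp (n / T ^ 2) := norm_liWeight_one_sub_le_exp_div n hx.2 hT
  have h3 : ‖(1 : ℂ) - liWeight n (x + T * I)‖ ≤ 1 + 1 :=
    (norm_sub_le _ _).trans (add_le_add (by simp) h1)
  have h4 : ‖(1 : ℂ) - liWeight n (1 - (x + T * I))‖ ≤ 1 + Real.exp (n / T ^ 2) :=
    (norm_sub_le _ _).trans (add_le_add (by simp) h2)
  rw [liCoSymWeight_eq]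
  calc ‖(1 - liWeight n (x + T * I)) + (1 - liWeight n (1 - (x + T * I)))‖
      ≤ ‖1 - liWeight n (x + T * I)‖ + ‖1 - liWeight n (1 - (x + T * I))‖ := norm_add_le _ _
    _ ≤ (1 + 1) + (1 + Real.exp (n / T ^ 2)) := add_le_add h3 h4
    _ = 3 + Real.exp (n / T ^ 2) := by ring

/-- **Co-weight decay at a large height**: `‖2 − k_n(x + iY)‖ ≤ 2ne/Y` for `x ∈ [1/2, 3/2]`, `Y > 0`, `Y² ≥ n`
(`|1 − F_n(s)| ≤ ne/|Im s|` on `Re s ≥ −1/2`, eng g5's `TailContour.norm_one_sub_liWeight_le`, applied to `w` and to the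
conjugate of `1 − w`). -/
theorem norm_liCoSymWeight_le_div (n : ℕ) {x Y : ℝ} (hx : x ∈ Icc (1 / 2 : ℝ) (3 / 2)) (hY : 0 < Y)
    (hn : (n : ℝ) ≤ Y ^ 2) : ‖liCoSymWeight n (x + Y * I)‖ ≤ 2 * (n * Real.exp 1 / Y) := by
  have h1 := TailContour.norm_one_sub_liWeight_le n (x := x) (by linarith [hx.1]) hY hn
  have h2 := TailContour.norm_one_sub_liWeight_le n (x := 1 - x) (by linarith [hx.2]) hY hn
  have hconj : (1 : ℂ) - (x + Y * I) = conj (((1 - x : ℝ) : ℂ) + Y * I) := by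
    apply Complex.ext <;> simp
  have hnorm : ∀ s : ℂ, ‖1 - liWeight n (conj s)‖ = ‖1 - liWeight n s‖ := by
    intro s
    rw [WindowContour.liWeight_conj, show (1 : ℂ) - conj (liWeight n s) = conj (1 - liWeight n s) by
      simp [map_sub], Complex.norm_conj]
  have h2' : ‖(1 : ℂ) - liWeight n (1 - (x + Y * I))‖ ≤ n * Real.exp 1 / Y := by
    rw [hconj, hnorm]; simpa using h2
  rw [liCoSymWeight_eq]
  calc ‖(1 - liWeight n (x + Y * I)) + (1 - liWeight n (1 - (x + Y * I)))‖
      ≤ ‖1 - liWeight n (x + Y * I)‖ + ‖1 - liWeight n (1 - (x + Y * I))‖ := norm_add_le _ _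
    _ ≤ n * Real.exp 1 / Y + n * Real.exp 1 / Y := add_le_add h1 h2'
    _ = 2 * (n * Real.exp 1 / Y) := by ring

/-- On the critical line the co-weight is twice the window weight: `2 − k_n(½ + it) = 2(1 − cos nθ(t)) = 2 f_n(t)`. -/
theorem liCoSymWeight_half_line (n : ℕ) {t : ℝ} (ht : t ≠ 0) :
    liCoSymWeight n (1 / 2 + t * I) = ((2 * liWindowWeight n t : ℝ) : ℂ) := by
  unfold liCoSymWeight
  rw [GammaShift.liSymWeight_half_line n ht]
  unfold liWindowWeight
  push_cast
  ring

/-! ### The gamma factor and the co-gamma integrand -/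

/-- The gamma factor `g(w) = −½ log π + ½ ψ(w/2)` of `ξ'/ξ`. -/
def gammaFactor (w : ℂ) : ℂ := -(Real.log Real.pi : ℂ) / 2 + 1 / 2 * Complex.digamma (w / 2)

/-- The co-gamma integrand `G̃_n(w) = g(w)(2 − k_n(w))` of the half-strip. -/
def coGammaIntegrand (n : ℕ) (w : ℂ) : ℂ := gammaFactor w * liCoSymWeight n w

/-- On the right edge `w = 3/2 + iy` the co-gamma integrand is eng g5's `TailContour.gammaIntegrand`. -/
theorem coGammaIntegrand_rightPt (n : ℕ) (y : ℝ) :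
    coGammaIntegrand n (3 / 2 + y * I) = TailContour.gammaIntegrand n y := rfl

/-- `‖g(x + iT)‖ ≤ ½ log(T + 4) + 5` for `x ∈ [1/2, 3/2]`, `T ≥ 1` (`‖ψ(w/2)‖ ≤ log(T + 4) + 8`, `0 ≤ log π ≤ 2`). -/
theorem norm_gammaFactor_le {x T : ℝ} (hx : x ∈ Icc (1 / 2 : ℝ) (3 / 2)) (hT : 1 ≤ T) :
    ‖gammaFactor (x + T * I)‖ ≤ Real.log (T + 4) / 2 + 5 := by
  have hT0 : 0 < T := by linarith
  set w : ℂ := x + T * I with hw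
  have hwre : 0 < (w / 2).re := by simp [hw]; linarith [hx.1]
  have hwim : 1 / 2 ≤ |(w / 2).im| := by
    simp [hw]; rw [abs_of_pos (by positivity)]; linarith
  have hwn : ‖w / 2‖ ≤ T + 3 := by
    rw [norm_div, Complex.norm_two]
    have : ‖w‖ ≤ |x| + |T| := by
      calc ‖w‖ ≤ ‖(x : ℂ)‖ + ‖(T : ℂ) * I‖ := norm_add_le _ _
        _ = |x| + |T| := by simp
    rw [abs_of_pos hT0, abs_of_pos (by linarith [hx.1])] at this
    linarith [hx.2]
  have hd := norm_digamma_le_log_height hwre hwim hwn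
  have hlogπ : ‖-(Real.log Real.pi : ℂ) / 2‖ ≤ 1 := by
    rw [norm_div, norm_neg, Complex.norm_real, Complex.norm_two, Real.norm_eq_abs,
      abs_of_nonneg (Real.log_nonneg (by linarith [Real.pi_gt_three]))]
    have : Real.log Real.pi ≤ 2 := by
      rw [Real.log_le_iff_le_exp Real.pi_pos]
      have h4 : Real.exp 2 = Real.exp 1 * Real.exp 1 := by rw [← Real.exp_add]; norm_num
      rw [h4]; nlinarith [Real.exp_one_gt_d9, Real.pi_lt_four]
    linarith
  unfold gammaFactor
  calc ‖-(Real.log Real.pi : ℂ) / 2 + 1 / 2 * Complex.digamma (w / 2)‖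
      ≤ ‖-(Real.log Real.pi : ℂ) / 2‖ + ‖(1 / 2 : ℂ) * Complex.digamma (w / 2)‖ := norm_add_le _ _
    _ ≤ 1 + 1 / 2 * (Real.log (T + 4) + 8) := by
        rw [norm_mul]
        gcongr
        simp
    _ = Real.log (T + 4) / 2 + 5 := by ring

/-- `G̃_n` is differentiable at every `w` with `Re w > 0`, `Im w ≠ 0`. -/
theorem differentiableAt_coGammaIntegrand (n : ℕ) {w : ℂ} (hre : 0 < w.re) (him : w.im ≠ 0) :
    DifferentiableAt ℂ (coGammaIntegrand n) w := by
  have hw0 : w ≠ 0 := fun h ↦ him (by simp [h])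
  have hw1 : (1 : ℂ) - w ≠ 0 := by
    intro h; apply him
    have := congrArg Complex.im h; simpa using this.symm
  have hψ : DifferentiableAt ℂ (fun z : ℂ ↦ Complex.digamma (z / 2)) w := by
    have hmem : w / 2 ∈ {s : ℂ | 0 < s.re} := by simp; positivity
    have hd := Literature.Analysis.SpecialFunctions.Complex.differentiableOn_digamma.differentiableAt
      ((isOpen_lt continuous_const Complex.continuous_re).mem_nhds hmem)
    exact hd.comp w (differentiableAt_id.div_const 2)
  have hk : DifferentiableAt ℂ (liCoSymWeight n) w := by
    have e : liCoSymWeight n = fun z ↦ 2 - (liWeight n z + liWeight n (1 - z)) := by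
      funext z; rfl
    rw [e]
    refine (differentiableAt_const _).sub ((GammaShift.differentiableAt_liWeight n hw0).add ?_)
    exact (GammaShift.differentiableAt_liWeight n hw1).comp w ((differentiableAt_const _).sub differentiableAt_id)
  have hg : DifferentiableAt ℂ gammaFactor w := by
    unfold gammaFactor
    exact (differentiableAt_const _).add ((differentiableAt_const _).mul hψ)
  have e2 : coGammaIntegrand n = fun z ↦ gammaFactor z * liCoSymWeight n z := by funext z; rfl
  rw [e2]
  exact hg.mul hk

/-- `G̃_n` is differentiable on every rectangle `[a, b] × [T₁, T₂]` with `a > 0`, `T₁ > 0`. -/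
theorem differentiableOn_coGammaIntegrand (n : ℕ) {a b T₁ T₂ : ℝ} (ha : 0 < a) (hab : a ≤ b) (hT₁ : 0 < T₁)
    (hT : T₁ ≤ T₂) : DifferentiableOn ℂ (coGammaIntegrand n) ([[a, b]] ×ℂ [[T₁, T₂]]) := by
  intro w hw
  rw [uIcc_of_le hab, uIcc_of_le hT, Complex.mem_reProdIm] at hw
  exact (differentiableAt_coGammaIntegrand n (ha.trans_le hw.1.1) (by linarith [hw.2.1])).differentiableWithinAt

/-- On the critical line the co-gamma integrand's real part is twice the smooth-tail integrand:
`Re G̃_n(½ + it) = 2 f_n(t) ϑ'(t)` (`t ≠ 0`). -/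
theorem re_coGammaIntegrand_half_line (n : ℕ) {t : ℝ} (ht : t ≠ 0) :
    (coGammaIntegrand n (1 / 2 + t * I)).re = 2 * liWindowWeight n t * liGammaDensity t := by
  unfold coGammaIntegrand
  rw [liCoSymWeight_half_line n ht, Complex.re_mul_ofReal]
  have harg : ((1 : ℂ) / 2 + t * I) / 2 = 1 / 4 + (t : ℂ) / 2 * I := by ring
  unfold gammaFactor
  rw [harg]
  unfold liGammaDensity
  rw [Complex.digamma_def]
  have hre : (-(Real.log Real.pi : ℂ) / 2 + 1 / 2 * logDeriv Complex.Gamma (1 / 4 + (t : ℂ) / 2 * I)).re =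
      -(Real.log Real.pi) / 2 + (logDeriv Complex.Gamma (1 / 4 + (t : ℂ) / 2 * I)).re / 2 := by
    simp [Complex.add_re, Complex.mul_re]
    ring
  rw [hre]
  ring

/-! ### The two connector bounds -/

/-- At the cut: `‖G̃_n(x + iT)‖ ≤ (½ log(T + 4) + 5)(3 + e^{n/T²})` for `x ∈ [1/2, 3/2]`, `T ≥ 1`. -/
theorem norm_coGammaIntegrand_le (n : ℕ) {x T : ℝ} (hx : x ∈ Icc (1 / 2 : ℝ) (3 / 2)) (hT : 1 ≤ T) :
    ‖coGammaIntegrand n (x + T * I)‖ ≤ (Real.log (T + 4) / 2 + 5) * (3 + Real.exp (n / T ^ 2)) := by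
  unfold coGammaIntegrand
  rw [norm_mul]
  have hlog0 : 0 ≤ Real.log (T + 4) := Real.log_nonneg (by linarith)
  exact mul_le_mul (norm_gammaFactor_le hx hT) (norm_liCoSymWeight_le n hx (by linarith)) (norm_nonneg _)
    (by linarith)

/-- At a large height: `‖G̃_n(x + iY)‖ ≤ (½ log(Y + 4) + 5)·2ne/Y` for `x ∈ [1/2, 3/2]`, `Y ≥ 1`, `Y² ≥ n`. -/
theorem norm_coGammaIntegrand_le_div (n : ℕ) {x Y : ℝ} (hx : x ∈ Icc (1 / 2 : ℝ) (3 / 2)) (hY : 1 ≤ Y)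
    (hn : (n : ℝ) ≤ Y ^ 2) :
    ‖coGammaIntegrand n (x + Y * I)‖ ≤ (Real.log (Y + 4) / 2 + 5) * (2 * (n * Real.exp 1 / Y)) := by
  unfold coGammaIntegrand
  rw [norm_mul]
  have hlog0 : 0 ≤ Real.log (Y + 4) := Real.log_nonneg (by linarith)
  exact mul_le_mul (norm_gammaFactor_le hx hY) (norm_liCoSymWeight_le_div n hx (by linarith) hn) (norm_nonneg _)
    (by linarith)

/-- **Connector at the cut**: `‖∫_{1/2}^{3/2} G̃_n(x + iT) dx‖ ≤ (½ log(T + 4) + 5)(3 + e^{n/T²})` (`T ≥ 1`). -/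
theorem norm_connector_le (n : ℕ) {T : ℝ} (hT : 1 ≤ T) :
    ‖∫ x in (1 / 2 : ℝ)..(3 / 2 : ℝ), coGammaIntegrand n (x + T * I)‖ ≤
      (Real.log (T + 4) / 2 + 5) * (3 + Real.exp (n / T ^ 2)) := by
  have hpt : ∀ x ∈ Ι (1 / 2 : ℝ) (3 / 2), ‖coGammaIntegrand n (x + T * I)‖ ≤
      (Real.log (T + 4) / 2 + 5) * (3 + Real.exp (n / T ^ 2)) := by
    intro x hx
    rw [uIoc_of_le (by norm_num)] at hx
    exact norm_coGammaIntegrand_le n ⟨hx.1.le, hx.2⟩ hT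
  have h := intervalIntegral.norm_integral_le_of_norm_le_const hpt
  have hlen : |(3 / 2 : ℝ) - 1 / 2| = 1 := by norm_num
  rw [hlen, mul_one] at h
  exact h

/-- **Connector at a large height**: `‖∫_{1/2}^{3/2} G̃_n(x + iY) dx‖ ≤ (½ log(Y + 4) + 5)·2ne/Y` (`Y ≥ 1`, `Y² ≥ n`). -/
theorem norm_connector_le_div (n : ℕ) {Y : ℝ} (hY : 1 ≤ Y) (hn : (n : ℝ) ≤ Y ^ 2) :
    ‖∫ x in (1 / 2 : ℝ)..(3 / 2 : ℝ), coGammaIntegrand n (x + Y * I)‖ ≤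
      (Real.log (Y + 4) / 2 + 5) * (2 * (n * Real.exp 1 / Y)) := by
  have hpt : ∀ x ∈ Ι (1 / 2 : ℝ) (3 / 2), ‖coGammaIntegrand n (x + Y * I)‖ ≤
      (Real.log (Y + 4) / 2 + 5) * (2 * (n * Real.exp 1 / Y)) := by
    intro x hx
    rw [uIoc_of_le (by norm_num)] at hx
    exact norm_coGammaIntegrand_le_div n ⟨hx.1.le, hx.2⟩ hY hn
  have h := intervalIntegral.norm_integral_le_of_norm_le_const hpt
  have hlen : |(3 / 2 : ℝ) - 1 / 2| = 1 := by norm_num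
  rw [hlen, mul_one] at h
  exact h

end GammaTail

end Summit.RiemannHypothesis.RiemannHypothesis.Theorems.LiTheory

end
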